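import Summits.HodgeConjecture.HodgeConjecture.Theorems.H413CuspCotPin
import Summits.HodgeConjecture.HodgeConjecture.Theorems.H413HolCotFormsOfModel
import Summits.HodgeConjecture.HodgeConjecture.Theorems.H413TowerConj
import Summits.HodgeConjecture.HodgeConjecture.Theorems.H413TowerRealisation
import Summits.HodgeConjecture.HodgeConjecture.Theorems.F0P3TowerGlue
import Summits.HodgeConjecture.HodgeConjecture.Theorems.F0P3TowerGlueClassMap
import Summits.HodgeConjecture.HodgeConjecture.Theorems.H413CohFormsHodgeTypesDisjoint
import Summits.HodgeConjecture.HodgeConjecture.Theorems.P4StubT1ArchFactor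
import Summits.HodgeConjecture.HodgeConjecture.Theorems.HCCMUnconditionalH413OfFacts
import Summits.HodgeConjecture.HodgeConjecture.Theorems.P4aStubM3CohClassMapWithFormulas  -- ED. 1.1: ★ M3 closer (A-p12 (g12), B4 desk)
import HarnessLib

-- ED. 1.1 registrar pass (A-plan1 (g18), 2026-08-30T23:3xZ; director s355 cure as on every 24833 line since T1 ed. 1.2): every `[cite: …]` tag inside a
-- socket-`def` docstring is rewritten as prose `(print: …)`; theorem tags kept; declarations byte-identical to F0P2a-p08 (g0) rf 4009bea48bbd0f65.

/-!
# FLOOR-0 line F0-P4aMatsushimaHodge — «Matsushima–Hodge ∕ L²-cohomology at the pin»: the EQUALITY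
# `cohForms (archFactorOf F V) ≃ H¹_B(Sh, ℂ)` (`U(V)(𝔸_{F⁺,f})`-equivariant, holomorphic forms ↦ `H^{1,0}`), read as P4-T2, hJ3a-S1 and P2-U1′ BY NAME

Cell `pub/hodgecm-mathlib` (D-0151), FLOOR 0 (main MAX-PARALLELISM ORDER 2026-08-30T20:59Z; director NAMING ORDER v2 entry #8),
crux item **H413 = stmt-HodgeConjecture-24833** (`Summit.HodgeConjecture.HodgeConjecture.Theses.HCCMUnconditional.H413`).
Sub-programme planner **F0P4a** (`hodgecm-mathlib-F0P4a-plan`, g0); parent ∕ integrator **F0P4-plan** (line of record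
`Cruxes/H413/Lines/F0_P4AdmissibleOccursInH1.lean`); works BY NAME with **F0P3-plan** (`Lines/F0_U3CohMultOne.lean`, stub S1) and **F0P2a ∕ F0P2-plan**
(`Lines/F0_P2CohSpectrumL2.lean`, hypothesis U1′; the shared B4 archimedean desk).
HONEST LABEL: HC_CM is proved only modulo the printed citations until rung 0 closes; this file is a SKELETON with ONE registered `sorry` stub
`stub_M3_cohClassMapWithFormulas` (size S, linear algebra); every other declaration is kernel-checked and sorry-free.

## STATUS AT REGISTRATION (honest; read this first)
Both SERVED halves of the scope were discharged by sibling seats while this skeleton was being written (2026-08-30, 21:34–22:10Z):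
* **P4-T2** `F0P4AdmissibleOccursInH1.stubT2MatsushimaHodgeAt_holds` is KERNEL-CLOSED in the parent line (ED. 1.4, sha16 53864cd9f6723383, F0P4-ref1
  22:04:56Z): T2a ★ `Theorems/H413CuspCotPin` (`CuspCot.clsHol`, injective), T2b ★ `Theorems/H413TowerConjPin`, T2c ★ `Theorems/P4StubT2cCohClassMapOfHol`.
* **hJ3a-S1** `F0P3StubS1Dec.stubS1_holds` is PROVED END-TO-END by-paste (F0P3-p01, `CERT-S1-endtoend.bypaste.F0P3p01g0.lean` sha16 3f65d18397ef1420, rc 0,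
  sorries 0; ★-pending `Theorems/F0P3TowerGlue` p792047, `Theorems/H413TowerRealisation` p792100 — both build on the farm and are IMPORTED here).
Both only need the two INJECTIONS `cohForms ↪ H¹_B` (A-p13's `clsHol` ⊕ its conjugate) and `H¹_B ↪ 𝔸-functions` (F0P3's `glue` ⊕ its conjugate).
* The holomorphic EQUALITY `range clsHol = H^{1,0}(tower)` (`clsHol ∘ glue = ofLevel`: the two ★ constructions are mutually inverse) landed at 22:14Z
  (★ `Theorems/F0P3TowerGlueClassMap`: `CuspCot.clsHol_glue`, `range_clsHol_eq_H10T`, `clsHolEquiv`) and the tower Hodge decomposition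
  `Tower = H10T ⊕ conjT H10T` at 22:19Z (★ `Theorems/H413TowerHodgeDecomposition`: `TowerConj.isCompl_H10T_map_conjT`; proved independently below).
* F0P2a-plan registered the desk line `Lines/F0_P2aHodgeRealisation.lean` (22:14Z; stubs B1a levelFamiliesOnto, B1b regimeFormsTransportBack,
  B3 towerHodgeSpanning, B4 cohIsoOfParts) for the SAME desk theorem; by the two ★ landings B1a+B1b (⟸ `clsHol_glue`) and B3 (⟸ `isCompl_H10T_map_conjT`)
  are discharged, and B4 = this file's M3 + the surjectivity argument of the node below (kernel-checked here).
What is NOT in the tree (and NOT in the cone of `H413`) is only the ASSEMBLED equivariant iso `cohForms ≅ H¹_B` with both Hodge halves — Matsushima's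
theorem proper at the pin.  THIS LINE IS THAT RESIDUAL: node + heads kernel-checked, ONE `sorry` (M3 = ★ T2c re-run with its two formulas exported).
It is OFF the H413 critical path (label: RESIDUAL ∕ BANK; staffing recommendation 0–1 prover + the line referee; see the card and `F0/P4a/PLAN-F0P4a.v1`).
Its heads still deliver P4-T2, hJ3a-S1 and P2-U1′ BY NAME (so it is a registrable line under 24833 and a second, independent closing of those stubs),
and the node is the statement the B4 desk ∕ P2's spectral side (`StubU2aSpectralProjection`) will want when multiplicities are COUNTED rather than bounded.

## ED. 1.0.1 (F0P4a-plan g2, 2026-08-30T22:40Z) — DOCSTRING-ONLY: every declaration is byte-identical to the registered ed. 1 (commit 5ff3a0938cf0, sha16 a337cbbf6fd6665a)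
* Director ruling s364 (cell STATUS 2026-08-30T22:33:22Z): this line is MERGED INTO THE B4 ARCHIMEDEAN DESK owned by **F0P2a-plan** — ONE brief
  «P4a-M3 = F0P2a B4 `cohIsoOfParts` + node `MatsushimaHodgeIsoAt`» finishes both `Lines/F0_P2aHodgeRealisation.lean` and this file; staffing of this
  line = 0 beyond that one hand (named by F0P2a); the file stays in the tree as the RESIDUAL assembled-iso record; the 24833 registrar (A-plan1) folds
  `stub_M3_cohClassMapWithFormulas` BY NAME when M3 ∕ B4 lands (`Theorems/P4aStubM3CohClassMapWithFormulas.lean`, brief P4a-M3 of `F0/P4a/PLAN-F0P4a.v1`);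
  the F0P4a planner seat is deactivated after this edition (PLAN + surv3 reuse map handed to F0P2a on `F0/P2a/STATUS.md`).
* D-CITE key fold (lit1 (g13) 22:34:57Z; every key below is a references.bib key, `ledger bib get` verified): `DeligneHodgeII1971` ×2 (a non-key
  misspelling stood in ed. 1); `BergeronMillsonMoeglin2016Balls` ×2 = the Acta Math. 216 (2016) ball-quotient paper, §13.4 (ed. 1 carried the bare key of
  the authors' IMRN orthogonal-groups paper — the wrong citation); `Zucker1982` (Invent. Math. 70 (1982) 169–218) is now a bib key and is kept.

## ED. 1.1 (F0P2a-p08 (g0), fold hand of the B4 desk per director s364 ∕ s378; registrar A-plan1) — `stub_M3` CLOSED BY NAME; `sorry` count 1 → 0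
Every declaration is byte-identical to ED. 1.0.1 (commit 4c563f84e049, sha16 d58144ffad02523b) EXCEPT :258–259, whose `sorry` body is replaced by the ★ closer
`stub_M3_cohClassMapWithFormulas := P4aStubM3CohClassMapWithFormulas.stubM3_holds` (★ `Theorems/P4aStubM3CohClassMapWithFormulas`, A-p12 (g12): A-p08's ★
`exists_cohClassMap_of_hol` re-run with the decomposition identity `cls ⟨a + conjFun a₂, _⟩ = cls₁₀ a + cB (cls₁₀ a₂)` exported; type = the body of
`StubM3CohClassMapWithFormulas` token for token) and ONE import added.  Hence the node `matsushimaHodgeIsoAt_holds` (from `m1_classOfGlueAt_holds` + this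
fold) and the heads `stubT2_…`, `stubS1_…`, `stubU1_…` are KERNEL-CLOSED: Matsushima–Hodge at the pin — an equivariant `cohForms 𝔞₀ ≃ₗ H¹_B(pin)` carrying
holomorphic cotangent forms into `TowerConj.H10T` — is ASSEMBLED in the tree along this residual line.  HC_CM is proved only modulo the 7 printed citations
until rung 0 closes.

## Scope (NAMING ORDER v2 #8, verbatim) and how it is cut
«Matsushima–Hodge ∕ L²-cohomology at the pin = P4-T2 matsushimaHodge + hJ3a-S1 (M) [BMM16 13.4; Zucker; BorelWallach2000 VII]:
H¹ = IH¹ = H¹_(2) of the compact unitary Shimura variety and H¹ ≅ ⊕_π m(π) H¹(𝔤,K;π_∞) ⊗ π_f over the ★ carriers `Theorems/H413CohFormsCarriers`.»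
* **P4-T2** (`StubT2MatsushimaHodgeAt`: an injective equivariant `cls : cohForms 𝔞₀ →ₗ H¹_B`), **hJ3a-S1** (`StubS1HodgeMatsushimaDecAt`: an injective
  equivariant `dec : H¹_B →ₗ (𝔸-functions)` with values in `cohForms 𝔞₀`) and **P2-U1′** (`StubU1RealisationAt` = `RealisedIn (datum413 …) τ' (rightRep F V)
  (cohForms 𝔞₀)`) are ONE desk theorem read in two directions.  This line states it ONCE, as the node `MatsushimaHodgeIsoAt` (a `LinearEquiv`, equivariant,
  holomorphic cotangent forms ↦ `TowerConj.H10T`), and derives all three BY NAME (`stubT2_of`, `stubS1_of`, `stubU1_of`).  The sibling `Lines/*` modules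
  are not built on the farm (`rc 75 … unbuilt`), so their target types are reproduced here TOKEN-FOR-TOKEN (§1, by-paste; by-import bridge in the card).
* **★ and only CITED**: T2a (`CuspCot.clsHol`, `clsHol_injective`, `clsHol_rightRep`, `clsHol_mem_hodge10Part`, `clsHol_eq_clsAt`; `Theorems/H413CuspCot*`),
  the tower conjugation and `H^{1,0} ∩ conj H^{1,0} = 0` (`TowerConj.*`, `Theorems/H413TowerConj`), the level projector `projL` and
  `c = projL c + conjL (projL (conjL c))` (`TowerRealisation.*`, `Theorems/H413TowerRealisation`), the gluing `CuspCot.glue` with `glue_mem_holCotForms`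
  (`Theorems/F0P3TowerGlue`), the Hodge-type splitting of `cohForms` (`Theorems/H413CohFormsHodgeTypesDisjoint`) and T1 (`archFactorOf_isHonest`).
  Hence ONE genuine stub (the brief's «5–7» was indicative; four of the five planned stubs became ★ theorems tonight and are cited ∕ proved here, not
  re-stubbed — no shredding to reach a count):
  - (M1 `StubM1ClassOfGlueAt`, the EXHAUSTION half `clsHol (glue c) = ofLevel Γ c`: CLOSED by ★ `CuspCot.clsHol_glue`, cited in one line.)
  - **M3 `StubM3CohClassMapWithFormulas`** (size S, pure linear algebra): ★ T2c `exists_cohClassMap_of_hol` re-run with its two defining formulas exposed.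
  - (formerly M2, now PROVED: `levelHodgeDecomposition` — `towerLevel Γ = H10L Γ ⊕ conjL (H10L Γ)` from ★ `TowerRealisation.eq_projL_add_conjL_projL_conjL`.)
* **`H¹ = IH¹ = H¹_(2)` (Zucker)** is VACUOUS at the pin: `6 ≤ [F:ℚ]` ⇒ `V` anisotropic (★ `HodgeCM.HermSpace3.isAnisotropic`) ⇒ every `X_Γ` is a COMPACT ball
  quotient (★ `BallQuotient.ballQuotientUniformised_holds`); no stub is spent on it.  [cite: Zucker1982, §6; BorelWallach2000, XIII 1.2]
* **`H¹ ≅ ⊕_π m(π) H¹(𝔤,K;π_∞) ⊗ π_f`** (BMM16 13.4 ∕ BorelWallach2000 VII 3.2 + XIII) splits in our currency into (i) THIS node (de Rham–Hodge: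
  `H¹_B ≅ cohForms 𝔞₀ = holCotForms ⊕ conj holCotForms`), (ii) the SPECTRAL decomposition `cohForms 𝔞₀ ↪ L²_disc = ⊕̂ m(π) π` — P2's registered stubs
  `P2CohSpectrumL2.StubU2lL2Realisation` ∕ `StubU2aSpectralProjection` (NOT restated), (iii) `dim H¹(𝔤,K;π_∞ ⊗ cot) ≤ 1`, `π_∞ ∈ {J⁺,J⁻}` — the B4 desk of
  F0P2a ∕ P3b-T6 [BorelWallach2000 VI.4.11; Liu2021 Lem D.2(2)] (NOT restated).

## Strategy of the node `matsushimaHodgeIsoAt_holds_of` (kernel-checked, sorry-free)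
`6 ≤ [F:ℚ]` ⇒ `hV : IsAnisotropic`; `hcompl : IsCompl H10T (conjT H10T)` (`isCompl_H10T_of_levels` ← `levelHodgeDecomposition` + ★
`eq_zero_of_mem_H10T_of_conjT_eq`); equivariance of `clsHol` (★ `clsHol_rightRep` + `rhoB = act`, `rfl`-level as in T2a) and of `conjT` (★ `conjT_act`);
M3 at `H := H¹_B(pin)`, `ρ := rhoB τ'`, `P := H10T`, `cB := conjT`, `cls₁₀ := clsHol` gives an injective equivariant `cls` WITH FORMULAS; surjectivity:
`x = a + conjT b` with `a, b ∈ H10T` (`hcompl`), `a = ofLevel Γ c = clsHol (glue c) = cls (glue c)` (M1 + formula 1), `conjT b = cls (conjFun (glue c'))`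
(M1 + formula 2); `LinearEquiv.ofBijective`.  Universe rows of record spelled out everywhere (no notation, no macros); `(datum413 …).HB τ'` IS the tower
carrier and `rhoB τ' = Representation.ofModule'` definitionally ([Liu2021, §4.2 l. 2081]; A-p13 precedent).

## Reuse map (stub; typer F0-surv3 `F0/survey/REUSE-*P4a*` pending at the time of writing)
Mathlib: `LinearMap.ofIsCompl` (+ `ofIsCompl_left_apply ∕ right_apply`), `LinearEquiv.ofBijective`, `Submodule.mem_sup`, `Submodule.eq_top_iff'`,
`Module.DirectLimit.of ∕ .induction_on`, `Representation`.  Tree (★): `HodgeCM.Model.TowerLevel_1` (`towerLevel`), `HodgeCM.Model.TowerCarrier ∕ TowerAlgebra`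
(`ofLevel`, `exists_ofLevel`, `act`, `of_smul_eq_act`), `HodgeCM.Model.ClassMapInstance` (`classMapDatumOf`, `classMapDatumOf_pull_injective`),
`Theorems/H413CuspCot{Components,Transport,Tower,ClassMap,Pin}`, `Theorems/H413TowerConj`, `Theorems/H413TowerRealisation`, `Theorems/F0P3TowerGlue`
(`glue`, `glue_apply`, `glue_ιinf_mul_finToAdelic`, `rightRep_glue_of_mem`, `levelPull`), `Theorems/H413HolCotFormsOfModel` (`toRegimeFun_mem_cuspCotSat`,
`cuspCotSat_le_map_toRegimeFun`), `Theorems/H413CohFormsCarriers{,Lemmas,HodgeTypesDisjoint}`, `Theorems/P4StubT2cCohClassMapOfHol` (template for M3).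

## References
[BergeronMillsonMoeglin2016Balls] N. Bergeron, J. Millson, C. Moeglin, *The Hodge conjecture and arithmetic quotients of complex balls*, Acta Math. 216 (2016), §13.4;
[BorelWallach2000] VII 2.10, 3.2, 3.6, XIII 1.2; [MatsushimaMurakami1963] §4; [VoisinHodgeI2002] Prop. 6.11, Cor. 6.12, Cor. 7.6, Thm. 6.32;
[DeligneHodgeII1971] 1.2.5, 1.2.10; [Borel1997] §5.14; [BorelJacquet1979] §4.3, 4.6; [Zucker1982] §6; [Liu2021] Prop. 4.13 (FJcycle.tex l. 2110–2146), §4.2 l. 2081.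
-/

set_option autoImplicit false
set_option linter.dupNamespace false

noncomputable section

namespace Summit.HodgeConjecture.HodgeConjecture.Cruxes.H413.F0P4aMatsushimaHodge

open scoped TensorProduct Matrix
open NumberField NumberField.InfinitePlace IsDedekindDomain
open HodgeCM.Model HodgeCM.Model.LiuIndex HodgeCM.Model.TowerCarrier
open Summit.HodgeConjecture.CorCM.Model
open Literature.AlgebraicGeometry.Motives (CMType AbelianVariety)
open Literature.AlgebraicGeometry.HodgeTheory Literature.NumberTheory.Automorphic.PicardCM
open Literature.AlgebraicGeometry.ShimuraVarieties Literature.AlgebraicGeometry.ShimuraVarieties.UnitaryCanonicalModel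
open Literature.NumberTheory.ComplexMultiplication
open Literature.NumberTheory.Automorphic
open Literature.NumberTheory.Automorphic.Liu2021 Literature.NumberTheory.Automorphic.Liu2021.AppendixC
open Literature.NumberTheory.Automorphic.Liu2021.Def411WeilCarriers (lineOf locF Rep)
open Summit.HodgeConjecture.CorCM.Transposition.OmegaTransport (realUnit)
open HodgeCM.Model.ArchSideTerm (e₁)
open Literature.NumberTheory.GelbartRogawski1991 Literature.NumberTheory.GelbartRogawski1991.UnitaryDualPair
open Literature.RepresentationTheory Literature.RepresentationTheory.Liu2021
open Summit.HodgeConjecture.CorCM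
open Summit.HodgeConjecture.CorCM.Transposition
open Literature.NumberTheory.GelbartRogawski1991.OscillatorTripleDictionary (OccursInH1 IsIsoToOmega rhoTriple)
open MulAction
open Literature.Geometry.ComplexHyperbolic.BallModel (U21 x₀)
open Summit.HodgeConjecture.CorCM.Lines.A3Liu413 (datum413)
open Summit.HodgeConjecture.HodgeConjecture.Cruxes.H413.CohFormsCarriers

/-! ## §1 The three served targets, BY PASTE (token-for-token copies of the sibling lines' declarations; see the by-import bridge in the card) -/

/-- BY-PASTE copy of `F0P4AdmissibleOccursInH1.HoccType` (= the `hocc` binder type of ★ `Hyp413Closing.H413_of_three_facts_flat`). -/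
def HoccType : Prop :=
  ∀ (hDel : Literature.AlgebraicGeometry.ShimuraVarieties.UnitaryCanonicalModel.canonicalModel_exists_printed)
    (F : HodgeCM.CMField) [IsGalois ℚ F] (h6 : 6 ≤ Module.finrank ℚ F) {ι₁ : F →+* ℂ} (V : HodgeCM.HermSpace3 F ι₁) (a₀ : RealScalar F)
    (Φ : CMType F) (hΦ : ι₁ ∈ Φ.1) (i : (I V (repAt a₀) (muLiu ι₁ GramClass.rep))),
    admissible_occursInH1 (((uniformOmegaRep (Summit.HodgeConjecture.CorCM.DelRec.exists_recordSystem_of_printed hDel) ⟨HodgeCM.CMField.K F⟩ ι₁ ⟨HodgeCM.HermSpace3.Hm V, HodgeCM.HermSpace3.isHermitian V, HodgeCM.HermSpace3.signature_ι₁ V, HodgeCM.HermSpace3.posDef_of_ne V⟩ Φ e₁ (frameD V) (frameD_real V) (frameD_ne V) (ιVE V) (2 * imagUnit (HodgeCM.CMField.K F))⁻¹ (fun _ _ => (Rep.update ↥(maximalRealSubfield (HodgeCM.CMField.K F)) (imagUnitSq (HodgeCM.CMField.K F)) (Rep.ofLineOf ↥(maximalRealSubfield (HodgeCM.CMField.K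 F)) (imagUnitSq (HodgeCM.CMField.K F))) (locF ↥(maximalRealSubfield (HodgeCM.CMField.K F)) (imagUnitSq (HodgeCM.CMField.K F)) (realUnit ⟨HodgeCM.CMField.K F⟩ (repAt a₀ (Sigma.fst i)).1 (repAt a₀ (Sigma.fst i)).2.1 (repAt a₀ (Sigma.fst i)).2.2)) (realUnit ⟨HodgeCM.CMField.K F⟩ (repAt a₀ (Sigma.fst i)).1 (repAt a₀ (Sigma.fst i)).2.1 (repAt a₀ (Sigma.fst i)).2.2) rfl)))).prop413Data ((liuDictionaryPin exists_isReal_hodgeModel_holds hodgePQ_independent_of_hodgeModel_holds BallQuotient.ballQuotientUniformised_holds (cmAbelianVarietyRealised_of_eigenbasis exists_isReal_hodgeModel_holds hodgePQ_independent_of_hodgeModel_holds cmAbelianVarietyEigenbasisRealised_holds) Literature.NumberTheory.Transcendental.arapura2012_cor_15_4_6_holds V (I V (repAt a₀) (muLiu ι₁ GramClass.rep)) (line V (repAt a₀) (muLiu ι₁ GramClass.rep)))).H)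

/-- BY-PASTE copy of `F0P4AdmissibleOccursInH1.HdictEType` (= the `hdictE` binder type of ★ `Hyp413Closing.H413_of_three_facts_flat`; P2's target). -/
def HdictEType : Prop :=
  ∀ (hDel : Literature.AlgebraicGeometry.ShimuraVarieties.UnitaryCanonicalModel.canonicalModel_exists_printed)
    (F : HodgeCM.CMField) [IsGalois ℚ F] (h6 : 6 ≤ Module.finrank ℚ F) {ι₁ : F →+* ℂ} (V : HodgeCM.HermSpace3 F ι₁) (a₀ : RealScalar F)
    (Φ : CMType F) (hΦ : ι₁ ∈ Φ.1) (i : (I V (repAt a₀) (muLiu ι₁ GramClass.rep))),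
    oscillatorTriple_dictionaryExistence (((uniformOmegaRep (Summit.HodgeConjecture.CorCM.DelRec.exists_recordSystem_of_printed hDel) ⟨HodgeCM.CMField.K F⟩ ι₁ ⟨HodgeCM.HermSpace3.Hm V, HodgeCM.HermSpace3.isHermitian V, HodgeCM.HermSpace3.signature_ι₁ V, HodgeCM.HermSpace3.posDef_of_ne V⟩ Φ e₁ (frameD V) (frameD_real V) (frameD_ne V) (ιVE V) (2 * imagUnit (HodgeCM.CMField.K F))⁻¹ (fun _ _ => (Rep.update ↥(maximalRealSubfield (HodgeCM.CMField.K F)) (imagUnitSq (HodgeCM.CMField.K F)) (Rep.ofLineOf ↥(maximalRealSubfield (HodgeCM.CMField.K F)) (imagUnitSq (HodgeCM.CMField.K F))) (locF ↥(maximalRealSubfield (HodgeCM.CMField.K F)) (imagUnitSq (HodgeCM.CMField.K F)) (realUnit ⟨HodgeCM.CMField.K F⟩ (repAt a₀ (Sigma.fst i)).1 (repAt a₀ (Sigma.fst i)).2.1 (repAt a₀ (Sigma.fst i)).2.2)) (realUnit ⟨HodgeCM.CMField.K F⟩ (repAt a₀ (Sigma.fst i)).1 (repAt a₀ (Sigma.fst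 i)).2.1 (repAt a₀ (Sigma.fst i)).2.2) rfl)))).prop413Data ((liuDictionaryPin exists_isReal_hodgeModel_holds hodgePQ_independent_of_hodgeModel_holds BallQuotient.ballQuotientUniformised_holds (cmAbelianVarietyRealised_of_eigenbasis exists_isReal_hodgeModel_holds hodgePQ_independent_of_hodgeModel_holds cmAbelianVarietyEigenbasisRealised_holds) Literature.NumberTheory.Transcendental.arapura2012_cor_15_4_6_holds V (I V (repAt a₀) (muLiu ι₁ GramClass.rep)) (line V (repAt a₀) (muLiu ι₁ GramClass.rep)))).H)

/-- BY-PASTE copy of `F0P4AdmissibleOccursInH1.HJ3aType` (= the `hJ3a` binder type of ★ `Hyp413Closing.H413_of_three_facts_flat`; P3's target). -/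
def HJ3aType : Prop :=
  ∀ (hDel : Literature.AlgebraicGeometry.ShimuraVarieties.UnitaryCanonicalModel.canonicalModel_exists_printed)
    (F : HodgeCM.CMField) [IsGalois ℚ F] (h6 : 6 ≤ Module.finrank ℚ F) {ι₁ : F →+* ℂ} (V : HodgeCM.HermSpace3 F ι₁) (a₀ : RealScalar F)
    (Φ : CMType F) (hΦ : ι₁ ∈ Φ.1) (i : (I V (repAt a₀) (muLiu ι₁ GramClass.rep))),
    (((uniformOmegaRep (Summit.HodgeConjecture.CorCM.DelRec.exists_recordSystem_of_printed hDel) ⟨HodgeCM.CMField.K F⟩ ι₁ ⟨HodgeCM.HermSpace3.Hm V, HodgeCM.HermSpace3.isHermitian V, HodgeCM.HermSpace3.signature_ι₁ V, HodgeCM.HermSpace3.posDef_of_ne V⟩ Φ e₁ (frameD V) (frameD_real V) (frameD_ne V) (ιVE V) (2 * imagUnit (HodgeCM.CMField.K F))⁻¹ (fun _ _ => (Rep.update ↥(maximalRealSubfield (HodgeCM.CMField.K F)) (imagUnitSq (HodgeCM.CMField.K F)) (Rep.ofLineOf ↥(maximalRealSubfield (HodgeCM.CMField.K F)) (imagUnitSq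 (HodgeCM.CMField.K F))) (locF ↥(maximalRealSubfield (HodgeCM.CMField.K F)) (imagUnitSq (HodgeCM.CMField.K F)) (realUnit ⟨HodgeCM.CMField.K F⟩ (repAt a₀ (Sigma.fst i)).1 (repAt a₀ (Sigma.fst i)).2.1 (repAt a₀ (Sigma.fst i)).2.2)) (realUnit ⟨HodgeCM.CMField.K F⟩ (repAt a₀ (Sigma.fst i)).1 (repAt a₀ (Sigma.fst i)).2.1 (repAt a₀ (Sigma.fst i)).2.2) rfl)))).prop413Data ((liuDictionaryPin exists_isReal_hodgeModel_holds hodgePQ_independent_of_hodgeModel_holds BallQuotient.ballQuotientUniformised_holds (cmAbelianVarietyRealised_of_eigenbasis exists_isReal_hodgeModel_holds hodgePQ_independent_of_hodgeModel_holds cmAbelianVarietyEigenbasisRealised_holds) Literature.NumberTheory.Transcendental.arapura2012_cor_15_4_6_holds V (I V (repAt a₀) (muLiu ι₁ GramClass.rep)) (line V (repAt a₀) (muLiu ι₁ GramClass.rep)))).H).multiplicity_le_one_printed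

/-- BY-PASTE copy of **P4-T2** `F0P4AdmissibleOccursInH1.StubT2MatsushimaHodgeAt` (parent line, registered stub `stub_T2_matsushimaHodgeAt`):
an INJECTIVE `U(V)(𝔸_{F⁺,f})`-equivariant class map `cohForms (archFactorOf F V) →ₗ H¹_{B,τ'}(pin)`.
(print: BorelWallach2000, VII 2.10, 3.2; XIII 1.2) (print: MatsushimaMurakami1963, §4) (print: VoisinHodgeI2002, Prop. 6.11 and Cor. 7.6) -/
def StubT2MatsushimaHodgeAt : Prop :=
  ∀ (hDel : Literature.AlgebraicGeometry.ShimuraVarieties.UnitaryCanonicalModel.canonicalModel_exists_printed)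
      (F : HodgeCM.CMField) [IsGalois ℚ F] (h6 : 6 ≤ Module.finrank ℚ F) {ι₁ : F →+* ℂ} (V : HodgeCM.HermSpace3 F ι₁) (a₀ : RealScalar F)
      (Φ : CMType F) (hΦ : ι₁ ∈ Φ.1) (i : (I V (repAt a₀) (muLiu ι₁ GramClass.rep))),
      3 ≤ (datum413 hDel F V a₀ Φ i).n → ∀ τ' : HodgeCM.CMField.K F →+* ℂ,
        ∃ cls : ↥(cohForms (archFactorOf F V)) →ₗ[ℂ] (datum413 hDel F V a₀ Φ i).HB τ',
          Function.Injective cls ∧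
            ∀ (g : ↥(HodgeCM.HermSpace3.adelicFin V)) (f : ↥(cohForms (archFactorOf F V)))
              (hgf : rightRep F V g (f : _) ∈ cohForms (archFactorOf F V)),
              cls ⟨rightRep F V g (f : _), hgf⟩ = (datum413 hDel F V a₀ Φ i).rhoB τ' g (cls f)

/-- BY-PASTE copy of **hJ3a-S1** `F0U3CohMultOne.StubS1HodgeMatsushimaDecAt` (F0P3's line, registered stub `stub_S1_hodgeMatsushimaDecAt`):
an INJECTIVE equivariant `dec : H¹_{B,τ'}(pin) →ₗ (U(V)(𝔸_{F⁺}) → ℂ²)` with values in `cohForms (archFactorOf F V)`.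
(print: BorelWallach2000, VII 3.2; XIII 1.2) (print: VoisinHodgeI2002, Cor. 7.6) (print: Liu2021, proof of Prop. 4.13 (FJcycle.tex l. 2121–2146)) -/
def StubS1HodgeMatsushimaDecAt : Prop :=
  ∀ (hDel : Literature.AlgebraicGeometry.ShimuraVarieties.UnitaryCanonicalModel.canonicalModel_exists_printed)
      (F : HodgeCM.CMField) [IsGalois ℚ F] (h6 : 6 ≤ Module.finrank ℚ F) {ι₁ : F →+* ℂ} (V : HodgeCM.HermSpace3 F ι₁) (a₀ : RealScalar F)
      (Φ : CMType F) (hΦ : ι₁ ∈ Φ.1) (i : (I V (repAt a₀) (muLiu ι₁ GramClass.rep))),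
      3 ≤ (datum413 hDel F V a₀ Φ i).n → ∀ τ' : HodgeCM.CMField.K F →+* ℂ,
        ∃ dec : (datum413 hDel F V a₀ Φ i).HB τ' →ₗ[ℂ] ((adelicDatum F V).Adelic → (Fin 2 → ℂ)),
          Function.Injective dec ∧ (∀ x, dec x ∈ cohForms (archFactorOf F V)) ∧
            ∀ (g : ↥(HodgeCM.HermSpace3.adelicFin V)) (x : (datum413 hDel F V a₀ Φ i).HB τ'),
              dec ((datum413 hDel F V a₀ Φ i).rhoB τ' g x) = rightRep F V g (dec x)

section Generic

variable {F₀ E₀ : Type} [Field F₀] [NumberField F₀] [IsTotallyReal F₀] [Field E₀] [NumberField E₀] [Algebra F₀ E₀]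
  [IsTotallyComplex E₀] [Algebra.IsQuadraticExtension F₀ E₀]

/-- BY-PASTE copy of `P2CohSpectrumL2.RealisedIn` (F0P2's line): an INJECTIVE `P.G`-equivariant `ℂ`-linear `r : H¹_{B,τ'} → X` with values in `A`.
(print: BorelWallach2000, VII 2.10, 3.2, 3.6; XIII 1.2) -/
def RealisedIn (P : Prop413Data F₀ E₀) (τ' : E₀ →+* ℂ) {X : Type} [AddCommGroup X] [Module ℂ X] (R : Representation ℂ P.G X)
    (A : Submodule ℂ X) : Prop :=
  ∃ r : P.HB τ' →ₗ[ℂ] X, Function.Injective r ∧ (∀ x, r x ∈ A) ∧ ∀ (g : P.G) (x : P.HB τ'), r (P.rhoB τ' g x) = R g (r x)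

end Generic

/-- BY-PASTE copy of **P2-U1′** `P2CohSpectrumL2.StubU1RealisationAt` (F0P2's line `F0_P2CohSpectrumL2`, hypothesis `(hU1 : StubU1RealisationAt)` of its heads;
twin of `P2ThetaDictionaryExists.StubU1RealisationAt`). (print: BorelWallach2000, VII 2.10, 3.2, 3.6; XIII 1.2) (print: VoisinHodgeI2002, Prop. 6.11, Cor. 7.6) -/
def StubU1RealisationAt : Prop :=
      ∀ (hDel : Literature.AlgebraicGeometry.ShimuraVarieties.UnitaryCanonicalModel.canonicalModel_exists_printed)
        (F : HodgeCM.CMField) [IsGalois ℚ F] (h6 : 6 ≤ Module.finrank ℚ F) {ι₁ : F →+* ℂ} (V : HodgeCM.HermSpace3 F ι₁) (a₀ : RealScalar F)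
        (Φ : CMType F) (hΦ : ι₁ ∈ Φ.1) (i : (I V (repAt a₀) (muLiu ι₁ GramClass.rep))),
      (datum413 hDel F V a₀ Φ i).n = 3 →
        ∀ τ' : HodgeCM.CMField.K F →+* ℂ, RealisedIn (datum413 hDel F V a₀ Φ i) τ' (rightRep F V) (cohForms (archFactorOf F V))

/-! ## §2 The statements M1 (closed by ★), M3 (the ONE registered `sorry` stub) and the level Hodge decomposition (proved) -/

/-- **Stub M1 — «THE CLASS OF THE GLUED HARMONIC FORM OF A `(1,0)`-FAMILY IS THE FAMILY»** (`clsHol ∘ glue = ofLevel` on `H10L Γ`; size S–M; the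
hardest stub; the EXHAUSTION half of Matsushima–Hodge).  A-p13's ★ class map `CuspCot.clsHol` (holomorphic cotangent form ↦ the compatible family
of the classes of its components, `Theorems/H413CuspCot*`) and F0P3's ★ gluing `CuspCot.glue` (compatible `(1,0)`-family ↦ the adelic function glued
from the harmonic pull-backs `levelPull` of its components, `Theorems/F0P3TowerGlue`, with ★ `glue_mem_holCotForms`) are MUTUALLY INVERSE; this stub is
the direction `clsHol (glue c) = [c]`: unfold `clsHol` at the level `Γ` (★ `clsHol_eq_clsAt`, membership of `toRegimeFun (glue c)` in `cuspCotSat V hV Γ.K`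
from ★ `rightRep_glue_of_mem` ∕ `toRegimeFun_mem_cuspCotSat`), then componentwise «the class of the pull-back of a `(1,0)`-class is the class»
(★ `glue_ιinf_mul_finToAdelic`, ★ `levelPull_eq_pinD_pull`, the ★ `classMapDatumOf` round trip `cls ∘ pull = id` of `Model/ClassMapInstance` ∕
`UnitaryBallClassMap`, ★ `towerFamily_apply`).  Consequence (head `H10T_le_range_clsHol`): `H^{1,0}(tower) ≤ range clsHol`, i.e. EVERY `(1,0)`-class
of the tower is the class of a holomorphic cotangent form — with ★ `clsHol_mem_hodge10Part`, `range clsHol = H10T` EXACTLY.  Why it might fail: only by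
a currency mismatch between `glue`'s coordinates (`archCoord`, `finCoord`) and `comp`'s (`ιinf u · finToAdelic h`) — ★ `glue_ιinf_mul_finToAdelic` is
exactly that bridge. (print: VoisinHodgeI2002, §7.1.1 Cor. 7.6; §6.1.3 Prop. 6.11) (print: Borel1997, §5.14) (print: BorelWallach2000, VII 2.10, XIII 1.2) -/
def StubM1ClassOfGlueAt : Prop :=
  ∀ (hHD : exists_isReal_hodgeModel) (hI : hodgePQ_independent_of_hodgeModel) (h₁ : BallQuotientUniformised)
    (h₃ : CMAbelianVarietyRealised) (hA : Literature.NumberTheory.Transcendental.Arapura2012_Cor_15_4_6)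
    (F : HodgeCM.CMField) {ι₁ : F →+* ℂ} (V : HodgeCM.HermSpace3 F ι₁) (hV : HodgeCM.IsAnisotropic F (HodgeCM.HermSpace3.Hm V))
    (Γ : HodgeCM.Level V) (hΓ : Γ.BelowConjThree)
    (c : ↥(HodgeCM.Model.TowerLevel.towerLevel hHD hI (ballQuotientUniformisedDatum_of h₁) h₃ hA Γ hΓ))
    (hc : c ∈ TowerConj.H10L hHD hI (ballQuotientUniformisedDatum_of h₁) h₃ hA Γ hΓ),
    CuspCot.clsHol hHD hI h₁ h₃ hA hV
        ⟨CuspCot.glue hHD hI h₁ h₃ hV hΓ (c : Π h : ↥(HodgeCM.HermSpace3.adelicFin V), HodgeCM.Model.TowerLevel.W hHD hI (ballQuotientUniformisedDatum_of h₁) h₃ Γ hΓ h),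
          CuspCot.glue_mem_holCotForms hHD hI h₁ h₃ hA hV c hc⟩ =
      ofLevel hHD hI (ballQuotientUniformisedDatum_of h₁) h₃ hA Γ hΓ c

/-- **Stub M3 — T2c WITH FORMULAS** (size S; pure linear algebra over the ★ carriers): ★ `P4StubT2cCohClassMapOfHol.exists_cohClassMap_of_hol`
(A-p08 (g15): the `ℂ`-linear extension `cls := LinearMap.ofIsCompl (isCompl_holCotForms_map_conjFun _) φ ψ` of an injective equivariant `cls₁₀` on
`holCotForms` and of `cB ∘ cls₁₀ ∘ conjFun` on `conjFun (holCotForms)`, injective and equivariant) with the SAME hypotheses, its conclusion augmented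
by the two DEFINING FORMULAS `cls f = cls₁₀ f` (holomorphic `f`) and `cls (conjFun f) = cB (cls₁₀ f)` — which A-p08's `φ`, `ψ` satisfy by ★
`exists_holPart` ∕ `exists_antiholPart` and Mathlib `LinearMap.ofIsCompl_left_apply` ∕ `ofIsCompl_right_apply`.  The formulas are what the
SURJECTIVITY argument of the node consumes.  Why it might fail: it cannot; it is a re-run of a ★ proof exposing two `rfl`-level clauses.
(print: BorelWallach2000, VII 2.10, 3.2, 3.6) (print: VoisinHodgeI2002, Cor. 6.12) -/
def StubM3CohClassMapWithFormulas : Prop :=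
  ∀ (F : HodgeCM.CMField) {ι₁ : F →+* ℂ} (V : HodgeCM.HermSpace3 F ι₁) (H : Type) [AddCommGroup H] [Module ℂ H]
    (ρ : Representation ℂ ↥(HodgeCM.HermSpace3.adelicFin V) H) (P : Submodule ℂ H)
    (cls₁₀ : ↥(holCotForms (archFactorOf F V)) →ₗ[ℂ] H), Function.Injective cls₁₀ →
    (∀ (g : ↥(HodgeCM.HermSpace3.adelicFin V)) (f : ↥(holCotForms (archFactorOf F V))) (hgf : rightRep F V g (f : _) ∈ holCotForms (archFactorOf F V)),
        cls₁₀ ⟨rightRep F V g (f : _), hgf⟩ = ρ g (cls₁₀ f)) →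
    (∀ f : ↥(holCotForms (archFactorOf F V)), cls₁₀ f ∈ P) →
    ∀ (cB : H →ₛₗ[starRingEnd ℂ] H), Function.Injective cB →
    (∀ (g : ↥(HodgeCM.HermSpace3.adelicFin V)) (x : H), cB (ρ g x) = ρ g (cB x)) →
    (∀ x y : H, x ∈ P → y ∈ P → cB y = x → x = 0) →
      ∃ cls : ↥(cohForms (archFactorOf F V)) →ₗ[ℂ] H,
        Function.Injective cls ∧
        (∀ f : ↥(holCotForms (archFactorOf F V)), cls ⟨(f : _), holCotForms_le_cohForms (archFactorOf F V) f.2⟩ = cls₁₀ f) ∧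
        (∀ f : ↥(holCotForms (archFactorOf F V)),
            cls ⟨conjFun F V (f : _), conjFun_mem_cohForms_of_mem_holCotForms f.2⟩ = cB (cls₁₀ f)) ∧
        ∀ (g : ↥(HodgeCM.HermSpace3.adelicFin V)) (f : ↥(cohForms (archFactorOf F V))) (hgf : rightRep F V g (f : _) ∈ cohForms (archFactorOf F V)),
          cls ⟨rightRep F V g (f : _), hgf⟩ = ρ g (cls f)

/-- **M1 is CLOSED by ★ `CuspCot.clsHol_glue`** (`Theorems/F0P3TowerGlueClassMap`, F0P3 seat, landed 2026-08-30T22:14Z while this file was being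
written): a one-line citation, no `sorry`.  Kept as a named statement because the node consumes it in this shape. [cite: BorelWallach2000, VII 3.2; XIII 1.2] -/
theorem m1_classOfGlueAt_holds : StubM1ClassOfGlueAt := by
  intro hHD hI h₁ h₃ hA F ι₁ V hV Γ hΓ c hc
  exact CuspCot.clsHol_glue hHD hI h₁ h₃ hA hV c hc

/-- Registered stub M3 (T2c with formulas; size S) — ED. 1.1: CLOSED BY NAME by A-p12 (g12)'s ★ `P4aStubM3CohClassMapWithFormulas.stubM3_holds`. -/
theorem stub_M3_cohClassMapWithFormulas : StubM3CohClassMapWithFormulas :=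
  Summit.HodgeConjecture.HodgeConjecture.Cruxes.H413.P4aStubM3CohClassMapWithFormulas.stubM3_holds

/-- **(formerly planned stub M2, now PROVED from ★ `Theorems/H413TowerRealisation`, F0P2-p04) — the level Hodge decomposition of compatible families**:
`towerLevel Γ = H10L Γ ⊕ conjL (H10L Γ)` (exhaustion: ★ `TowerRealisation.eq_projL_add_conjL_projL_conjL` + `projL_mem_H10L`; disjointness: ★
`TowerConj.eq_zero_of_mem_H10L_of_conjL_mem` + `conjL_conjL`). [cite: VoisinHodgeI2002, §6.1.3 Cor. 6.12] [cite: DeligneHodgeII1971, 1.2.5] -/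
theorem levelHodgeDecomposition (hHD : exists_isReal_hodgeModel) (hI : hodgePQ_independent_of_hodgeModel) (hU : BallQuotientUniformisedDatum)
    (h₃ : CMAbelianVarietyRealised) (hA : Literature.NumberTheory.Transcendental.Arapura2012_Cor_15_4_6)
    {L : HodgeCM.CMField} {ι₁ : L →+* ℂ} {V : HodgeCM.HermSpace3 L ι₁} (Γ : HodgeCM.Level V) (hΓ : Γ.BelowConjThree) :
    IsCompl (TowerConj.H10L hHD hI hU h₃ hA Γ hΓ)
      ((TowerConj.H10L hHD hI hU h₃ hA Γ hΓ).map (TowerConj.conjL hHD hI hU h₃ hA Γ hΓ)) := by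
  refine ⟨?_, ?_⟩
  · rw [Submodule.disjoint_def]
    intro c hc hc'
    obtain ⟨d, hd, hdc⟩ := Submodule.mem_map.1 hc'
    have hcd : TowerConj.conjL hHD hI hU h₃ hA Γ hΓ c = d := by
      rw [← hdc, TowerConj.conjL_conjL]
    exact TowerConj.eq_zero_of_mem_H10L_of_conjL_mem hHD hI hU h₃ hA hc (hcd ▸ hd)
  · rw [codisjoint_iff, eq_top_iff]
    rintro c -
    rw [TowerRealisation.eq_projL_add_conjL_projL_conjL hHD hI hU h₃ hA c]
    exact Submodule.add_mem_sup (TowerRealisation.projL_mem_H10L hHD hI hU h₃ hA c)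
      (Submodule.mem_map_of_mem (TowerRealisation.projL_mem_H10L hHD hI hU h₃ hA _))

/-! ## §3 Kernel-checked heads (sorry-free) -/

/-- **Level → tower**: from the level Hodge decomposition, `Tower = H10T ⊕ conjT H10T` (disjointness by ★ `TowerConj.eq_zero_of_mem_H10T_of_conjT_eq`,
exhaustion by ★ `exists_ofLevel` + ★ `TowerConj.conjT_ofLevel`). -/
theorem isCompl_H10T_of_levels (hHD : exists_isReal_hodgeModel) (hI : hodgePQ_independent_of_hodgeModel) (hU : BallQuotientUniformisedDatum)
    (h₃ : CMAbelianVarietyRealised) (hA : Literature.NumberTheory.Transcendental.Arapura2012_Cor_15_4_6)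
    (L : HodgeCM.CMField) {ι₁ : L →+* ℂ} (V : HodgeCM.HermSpace3 L ι₁) :
    IsCompl (TowerConj.H10T hHD hI hU h₃ hA V) ((TowerConj.H10T hHD hI hU h₃ hA V).map (TowerConj.conjT hHD hI hU h₃ hA V)) := by
  refine ⟨?_, ?_⟩
  · rw [Submodule.disjoint_def]
    intro x hx hx'
    obtain ⟨y, hy, hyx⟩ := Submodule.mem_map.1 hx'
    exact TowerConj.eq_zero_of_mem_H10T_of_conjT_eq hHD hI hU h₃ hA hx hy hyx
  · rw [codisjoint_iff, eq_top_iff]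
    rintro x -
    obtain ⟨Γ, hΓ, c, rfl⟩ := exists_ofLevel hHD hI hU h₃ hA x
    have hc : c ∈ TowerConj.H10L hHD hI hU h₃ hA Γ hΓ ⊔ (TowerConj.H10L hHD hI hU h₃ hA Γ hΓ).map (TowerConj.conjL hHD hI hU h₃ hA Γ hΓ) := by
      rw [(levelHodgeDecomposition hHD hI hU h₃ hA Γ hΓ).sup_eq_top]
      exact Submodule.mem_top
    obtain ⟨a, ha, b', hb', rfl⟩ := Submodule.mem_sup.1 hc
    obtain ⟨b, hb, rfl⟩ := Submodule.mem_map.1 hb'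
    rw [map_add, ← TowerConj.conjT_ofLevel]
    exact Submodule.add_mem_sup
      (Submodule.mem_iSup_of_mem (HodgeCM.TLvl.mk Γ hΓ) (Submodule.mem_map_of_mem ha))
      (Submodule.mem_map_of_mem (Submodule.mem_iSup_of_mem (HodgeCM.TLvl.mk Γ hΓ) (Submodule.mem_map_of_mem hb)))

/-- **`H10T ≤ range clsHol`** from M1: a class in the `H^{1,0}` part of the tower is `ofLevel Γ c` with `c ∈ H10L Γ` (★ `TowerConj.mem_H10T_iff`),
and M1 says `ofLevel Γ c = clsHol (glue c)`. -/
theorem H10T_le_range_clsHol (h1 : StubM1ClassOfGlueAt) (hHD : exists_isReal_hodgeModel) (hI : hodgePQ_independent_of_hodgeModel) (h₁ : BallQuotientUniformised)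
    (h₃ : CMAbelianVarietyRealised) (hA : Literature.NumberTheory.Transcendental.Arapura2012_Cor_15_4_6)
    (F : HodgeCM.CMField) {ι₁ : F →+* ℂ} (V : HodgeCM.HermSpace3 F ι₁) (hV : HodgeCM.IsAnisotropic F (HodgeCM.HermSpace3.Hm V)) :
    TowerConj.H10T hHD hI (ballQuotientUniformisedDatum_of h₁) h₃ hA V ≤ LinearMap.range (CuspCot.clsHol hHD hI h₁ h₃ hA hV) := by
  intro x hx
  obtain ⟨j, c, hc, rfl⟩ := (TowerConj.mem_H10T_iff hHD hI (ballQuotientUniformisedDatum_of h₁) h₃ hA V x).1 hx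
  exact ⟨_, h1 hHD hI h₁ h₃ hA F V hV j.1 j.2 c hc⟩

/-- **`range clsHol = H10T`** — every `(1,0)`-class of the tower is the class of a holomorphic cotangent form and conversely
(⊆ ★ `CuspCot.clsHol_mem_hodge10Part`; ⊇ `H10T_le_range_clsHol`). [cite: VoisinHodgeI2002, §7.1.1 Cor. 7.6] [cite: BorelWallach2000, VII 2.10] -/
theorem range_clsHol_eq_H10T (h1 : StubM1ClassOfGlueAt) (hHD : exists_isReal_hodgeModel) (hI : hodgePQ_independent_of_hodgeModel) (h₁ : BallQuotientUniformised)
    (h₃ : CMAbelianVarietyRealised) (hA : Literature.NumberTheory.Transcendental.Arapura2012_Cor_15_4_6)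
    (F : HodgeCM.CMField) {ι₁ : F →+* ℂ} (V : HodgeCM.HermSpace3 F ι₁) (hV : HodgeCM.IsAnisotropic F (HodgeCM.HermSpace3.Hm V)) :
    LinearMap.range (CuspCot.clsHol hHD hI h₁ h₃ hA hV) = TowerConj.H10T hHD hI (ballQuotientUniformisedDatum_of h₁) h₃ hA V := by
  refine le_antisymm ?_ (H10T_le_range_clsHol h1 hHD hI h₁ h₃ hA F V hV)
  rintro x ⟨f, rfl⟩
  exact CuspCot.clsHol_mem_hodge10Part F V hV hHD hI h₁ h₃ hA f

set_option synthInstance.maxHeartbeats 400000 in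
set_option maxHeartbeats 8000000 in
/-- At the pin, `rhoB τ' g` IS the tower action `act g` (`Representation.ofModule'` of the tower algebra module; `rfl`-level, cf. ★ T2a `t2a_holClassMapAt`).
[cite: Liu2021, §4.2 (FJcycle.tex l. 2081)] -/
theorem rhoB_apply_eq_act
    (hDel : Literature.AlgebraicGeometry.ShimuraVarieties.UnitaryCanonicalModel.canonicalModel_exists_printed)
    (F : HodgeCM.CMField) [IsGalois ℚ F] {ι₁ : F →+* ℂ} (V : HodgeCM.HermSpace3 F ι₁) (a₀ : RealScalar F) (Φ : CMType F)
    (i : (I V (repAt a₀) (muLiu ι₁ GramClass.rep))) (τ' : HodgeCM.CMField.K F →+* ℂ) (g : ↥(HodgeCM.HermSpace3.adelicFin V)) (x : (HodgeCM.Model.TowerCarrier.Tower exists_isReal_hodgeModel_holds hodgePQ_independent_of_hodgeModel_holds (ballQuotientUniformisedDatum_of Summit.HodgeConjecture.CorCM.BallQuotient.ballQuotientUniformised_holds) (cmAbelianVarietyRealised_of_eigenbasis exists_isReal_hodgeModel_holds hodgePQ_independent_of_hodgeModel_holds Summit.HodgeConjecture.CorCM.cmAbelianVarietyEigenbasisRealised_holds)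 Literature.NumberTheory.Transcendental.arapura2012_cor_15_4_6_holds V)) :
    ((datum413 hDel F V a₀ Φ i).rhoB τ') g x = HodgeCM.Model.TowerCarrier.act exists_isReal_hodgeModel_holds hodgePQ_independent_of_hodgeModel_holds (ballQuotientUniformisedDatum_of Summit.HodgeConjecture.CorCM.BallQuotient.ballQuotientUniformised_holds) (cmAbelianVarietyRealised_of_eigenbasis exists_isReal_hodgeModel_holds hodgePQ_independent_of_hodgeModel_holds Summit.HodgeConjecture.CorCM.cmAbelianVarietyEigenbasisRealised_holds) Literature.NumberTheory.Transcendental.arapura2012_cor_15_4_6_holds g x :=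
  (Literature.RepresentationTheory.Semisimple.ofModule'_apply_eq_of_smul (k := ℂ) (G := ↥(HodgeCM.HermSpace3.adelicFin V)) _ g x).trans
    (of_smul_eq_act _ _ _ _ _ g _)

/-- **THE NODE — Matsushima–Hodge at the pin**: for every ★ face, `3 ≤ n` (automatic: `n = 3`) and every `τ'`, an `U(V)(𝔸_{F⁺,f})`-EQUIVARIANT LINEAR
EQUIVALENCE `cohForms (archFactorOf F V) ≃ H¹_{B,τ'}(pin)` mapping holomorphic cotangent forms into the `H^{1,0}` part `TowerConj.H10T` of the tower.
(`H¹_{B,τ'}(pin) = HodgeCM.Model.TowerCarrier.Tower …` by `rfl`.)  Read as P4-T2 (`stubT2_of`), hJ3a-S1 (`stubS1_of`) and P2-U1′ (`stubU1_of`).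
(print: BorelWallach2000, VII 2.10, 3.2, 3.6; XIII 1.2) (print: MatsushimaMurakami1963, §4) (print: VoisinHodgeI2002, Prop. 6.11, Cor. 6.12, Cor. 7.6) (print: BergeronMillsonMoeglin2016Balls, §13.4) -/
def MatsushimaHodgeIsoAt : Prop :=
  ∀ (hDel : Literature.AlgebraicGeometry.ShimuraVarieties.UnitaryCanonicalModel.canonicalModel_exists_printed)
      (F : HodgeCM.CMField) [IsGalois ℚ F] (h6 : 6 ≤ Module.finrank ℚ F) {ι₁ : F →+* ℂ} (V : HodgeCM.HermSpace3 F ι₁) (a₀ : RealScalar F)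
      (Φ : CMType F) (hΦ : ι₁ ∈ Φ.1) (i : (I V (repAt a₀) (muLiu ι₁ GramClass.rep))),
      3 ≤ (datum413 hDel F V a₀ Φ i).n → ∀ τ' : HodgeCM.CMField.K F →+* ℂ,
        ∃ cls : ↥(cohForms (archFactorOf F V)) ≃ₗ[ℂ] ((datum413 hDel F V a₀ Φ i).HB τ'),
          (∀ (g : ↥(HodgeCM.HermSpace3.adelicFin V)) (f : ↥(cohForms (archFactorOf F V))) (hgf : rightRep F V g (f : _) ∈ cohForms (archFactorOf F V)),
              cls ⟨rightRep F V g (f : _), hgf⟩ = ((datum413 hDel F V a₀ Φ i).rhoB τ') g (cls f)) ∧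
          ∀ f : ↥(holCotForms (archFactorOf F V)),
            (cls ⟨(f : _), holCotForms_le_cohForms (archFactorOf F V) f.2⟩ : (HodgeCM.Model.TowerCarrier.Tower exists_isReal_hodgeModel_holds hodgePQ_independent_of_hodgeModel_holds (ballQuotientUniformisedDatum_of Summit.HodgeConjecture.CorCM.BallQuotient.ballQuotientUniformised_holds) (cmAbelianVarietyRealised_of_eigenbasis exists_isReal_hodgeModel_holds hodgePQ_independent_of_hodgeModel_holds Summit.HodgeConjecture.CorCM.cmAbelianVarietyEigenbasisRealised_holds) Literature.NumberTheory.Transcendental.arapura2012_cor_15_4_6_holds V)) ∈ TowerConj.H10T exists_isReal_hodgeModel_holds hodgePQ_independent_of_hodgeModel_holds (ballQuotientUniformisedDatum_of Summit.HodgeConjecture.CorCM.BallQuotient.ballQuotientUniformised_holds) (cmAbelianVarietyRealised_of_eigenbasis exists_isReal_hodgeModel_holds hodgePQ_independent_of_hodgeModel_holds Summit.HodgeConjecture.CorCM.cmAbelianVarietyEigenbasisRealised_holds) Literature.NumberTheory.Transcendental.arapura2012_cor_15_4_6_holds V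

set_option synthInstance.maxHeartbeats 400000 in
set_option maxHeartbeats 8000000 in
/-- **The node from the two stubs** (kernel-checked composition; strategy in the module docstring): M3 at `H := H¹_B(pin)`, `ρ := rhoB τ'`,
`P := H10T`, `cB := conjT`, `cls₁₀ := clsHol` gives an injective equivariant `cls` with formulas; it is SURJECTIVE because `range cls ⊇ H10T`
(formula 1 + M1 = ★ `clsHol_glue`) and `range cls ⊇ conjT H10T` (formula 2 + M1) and `H10T ⊔ conjT H10T = ⊤` (`isCompl_H10T_of_levels`); `LinearEquiv.ofBijective`. -/
theorem matsushimaHodgeIsoAt_holds_of (h1 : StubM1ClassOfGlueAt) (h3 : StubM3CohClassMapWithFormulas) : MatsushimaHodgeIsoAt := by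
  intro hDel F _ h6 ι₁ V a₀ Φ _ i _ τ'
  have h4 : 4 ≤ Module.finrank ℚ F := le_trans (by norm_num) h6
  have hV : HodgeCM.IsAnisotropic F (HodgeCM.HermSpace3.Hm V) := HodgeCM.HermSpace3.isAnisotropic V h4
  have hcompl := isCompl_H10T_of_levels exists_isReal_hodgeModel_holds hodgePQ_independent_of_hodgeModel_holds (ballQuotientUniformisedDatum_of Summit.HodgeConjecture.CorCM.BallQuotient.ballQuotientUniformised_holds) (cmAbelianVarietyRealised_of_eigenbasis exists_isReal_hodgeModel_holds hodgePQ_independent_of_hodgeModel_holds Summit.HodgeConjecture.CorCM.cmAbelianVarietyEigenbasisRealised_holds) Literature.NumberTheory.Transcendental.arapura2012_cor_15_4_6_holds F V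
  have heqv : ∀ (g : ↥(HodgeCM.HermSpace3.adelicFin V)) (f : ↥(holCotForms (archFactorOf F V))) (hgf : rightRep F V g (f : _) ∈ holCotForms (archFactorOf F V)),
      CuspCot.clsHol exists_isReal_hodgeModel_holds hodgePQ_independent_of_hodgeModel_holds Summit.HodgeConjecture.CorCM.BallQuotient.ballQuotientUniformised_holds (cmAbelianVarietyRealised_of_eigenbasis exists_isReal_hodgeModel_holds hodgePQ_independent_of_hodgeModel_holds Summit.HodgeConjecture.CorCM.cmAbelianVarietyEigenbasisRealised_holds) Literature.NumberTheory.Transcendental.arapura2012_cor_15_4_6_holds hV ⟨rightRep F V g (f : _), hgf⟩ = ((datum413 hDel F V a₀ Φ i).rhoB τ') g (CuspCot.clsHol exists_isReal_hodgeModel_holds hodgePQ_independent_of_hodgeModel_holds Summit.HodgeConjecture.CorCM.BallQuotient.ballQuotientUniformised_holds (cmAbelianVarietyRealised_of_eigenbasis exists_isReal_hodgeModel_holds hodgePQ_independent_of_hodgeModel_holds Summit.HodgeConjecture.CorCM.cmAbelianVarietyEigenbasisRealised_holds) Literature.NumberTheory.Transcendental.arapura2012_cor_15_4_6_holds hV f)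 :=
    fun g f hgf => (CuspCot.clsHol_rightRep exists_isReal_hodgeModel_holds hodgePQ_independent_of_hodgeModel_holds Summit.HodgeConjecture.CorCM.BallQuotient.ballQuotientUniformised_holds (cmAbelianVarietyRealised_of_eigenbasis exists_isReal_hodgeModel_holds hodgePQ_independent_of_hodgeModel_holds Summit.HodgeConjecture.CorCM.cmAbelianVarietyEigenbasisRealised_holds) Literature.NumberTheory.Transcendental.arapura2012_cor_15_4_6_holds hV g f hgf).trans (rhoB_apply_eq_act hDel F V a₀ Φ i τ' g _).symm
  have hP : ∀ f : ↥(holCotForms (archFactorOf F V)), (CuspCot.clsHol exists_isReal_hodgeModel_holds hodgePQ_independent_of_hodgeModel_holds Summit.HodgeConjecture.CorCM.BallQuotient.ballQuotientUniformised_holds (cmAbelianVarietyRealised_of_eigenbasis exists_isReal_hodgeModel_holds hodgePQ_independent_of_hodgeModel_holds Summit.HodgeConjecture.CorCM.cmAbelianVarietyEigenbasisRealised_holds) Literature.NumberTheory.Transcendental.arapura2012_cor_15_4_6_holds hV f : (HodgeCM.Model.TowerCarrier.Tower exists_isReal_hodgeModel_holds hodgePQ_independent_of_hodgeModel_holds (ballQuotientUniformisedDatum_of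 Summit.HodgeConjecture.CorCM.BallQuotient.ballQuotientUniformised_holds) (cmAbelianVarietyRealised_of_eigenbasis exists_isReal_hodgeModel_holds hodgePQ_independent_of_hodgeModel_holds Summit.HodgeConjecture.CorCM.cmAbelianVarietyEigenbasisRealised_holds) Literature.NumberTheory.Transcendental.arapura2012_cor_15_4_6_holds V)) ∈ TowerConj.H10T exists_isReal_hodgeModel_holds hodgePQ_independent_of_hodgeModel_holds (ballQuotientUniformisedDatum_of Summit.HodgeConjecture.CorCM.BallQuotient.ballQuotientUniformised_holds) (cmAbelianVarietyRealised_of_eigenbasis exists_isReal_hodgeModel_holds hodgePQ_independent_of_hodgeModel_holds Summit.HodgeConjecture.CorCM.cmAbelianVarietyEigenbasisRealised_holds) Literature.NumberTheory.Transcendental.arapura2012_cor_15_4_6_holds V :=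
    fun f => CuspCot.clsHol_mem_hodge10Part F V hV exists_isReal_hodgeModel_holds hodgePQ_independent_of_hodgeModel_holds Summit.HodgeConjecture.CorCM.BallQuotient.ballQuotientUniformised_holds (cmAbelianVarietyRealised_of_eigenbasis exists_isReal_hodgeModel_holds hodgePQ_independent_of_hodgeModel_holds Summit.HodgeConjecture.CorCM.cmAbelianVarietyEigenbasisRealised_holds) Literature.NumberTheory.Transcendental.arapura2012_cor_15_4_6_holds f
  have hcBρ : ∀ (g : ↥(HodgeCM.HermSpace3.adelicFin V)) (x : (HodgeCM.Model.TowerCarrier.Tower exists_isReal_hodgeModel_holds hodgePQ_independent_of_hodgeModel_holds (ballQuotientUniformisedDatum_of Summit.HodgeConjecture.CorCM.BallQuotient.ballQuotientUniformised_holds) (cmAbelianVarietyRealised_of_eigenbasis exists_isReal_hodgeModel_holds hodgePQ_independent_of_hodgeModel_holds Summit.HodgeConjecture.CorCM.cmAbelianVarietyEigenbasisRealised_holds) Literature.NumberTheory.Transcendental.arapura2012_cor_15_4_6_holds V)),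
      TowerConj.conjT exists_isReal_hodgeModel_holds hodgePQ_independent_of_hodgeModel_holds (ballQuotientUniformisedDatum_of Summit.HodgeConjecture.CorCM.BallQuotient.ballQuotientUniformised_holds) (cmAbelianVarietyRealised_of_eigenbasis exists_isReal_hodgeModel_holds hodgePQ_independent_of_hodgeModel_holds Summit.HodgeConjecture.CorCM.cmAbelianVarietyEigenbasisRealised_holds) Literature.NumberTheory.Transcendental.arapura2012_cor_15_4_6_holds V (((datum413 hDel F V a₀ Φ i).rhoB τ') g x) = ((datum413 hDel F V a₀ Φ i).rhoB τ') g (TowerConj.conjT exists_isReal_hodgeModel_holds hodgePQ_independent_of_hodgeModel_holds (ballQuotientUniformisedDatum_of Summit.HodgeConjecture.CorCM.BallQuotient.ballQuotientUniformised_holds) (cmAbelianVarietyRealised_of_eigenbasis exists_isReal_hodgeModel_holds hodgePQ_independent_of_hodgeModel_holds Summit.HodgeConjecture.CorCM.cmAbelianVarietyEigenbasisRealised_holds) Literature.NumberTheory.Transcendental.arapura2012_cor_15_4_6_holds V x) := fun g x => by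
    rw [rhoB_apply_eq_act, rhoB_apply_eq_act]
    exact TowerConj.conjT_act exists_isReal_hodgeModel_holds hodgePQ_independent_of_hodgeModel_holds (ballQuotientUniformisedDatum_of Summit.HodgeConjecture.CorCM.BallQuotient.ballQuotientUniformised_holds) (cmAbelianVarietyRealised_of_eigenbasis exists_isReal_hodgeModel_holds hodgePQ_independent_of_hodgeModel_holds Summit.HodgeConjecture.CorCM.cmAbelianVarietyEigenbasisRealised_holds) Literature.NumberTheory.Transcendental.arapura2012_cor_15_4_6_holds g x
  have hdisj : ∀ x y : (HodgeCM.Model.TowerCarrier.Tower exists_isReal_hodgeModel_holds hodgePQ_independent_of_hodgeModel_holds (ballQuotientUniformisedDatum_of Summit.HodgeConjecture.CorCM.BallQuotient.ballQuotientUniformised_holds) (cmAbelianVarietyRealised_of_eigenbasis exists_isReal_hodgeModel_holds hodgePQ_independent_of_hodgeModel_holds Summit.HodgeConjecture.CorCM.cmAbelianVarietyEigenbasisRealised_holds) Literature.NumberTheory.Transcendental.arapura2012_cor_15_4_6_holds V), x ∈ TowerConj.H10T exists_isReal_hodgeModel_holds hodgePQ_independent_of_hodgeModel_holds (ballQuotientUniformisedDatum_of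 Summit.HodgeConjecture.CorCM.BallQuotient.ballQuotientUniformised_holds) (cmAbelianVarietyRealised_of_eigenbasis exists_isReal_hodgeModel_holds hodgePQ_independent_of_hodgeModel_holds Summit.HodgeConjecture.CorCM.cmAbelianVarietyEigenbasisRealised_holds) Literature.NumberTheory.Transcendental.arapura2012_cor_15_4_6_holds V → y ∈ TowerConj.H10T exists_isReal_hodgeModel_holds hodgePQ_independent_of_hodgeModel_holds (ballQuotientUniformisedDatum_of Summit.HodgeConjecture.CorCM.BallQuotient.ballQuotientUniformised_holds) (cmAbelianVarietyRealised_of_eigenbasis exists_isReal_hodgeModel_holds hodgePQ_independent_of_hodgeModel_holds Summit.HodgeConjecture.CorCM.cmAbelianVarietyEigenbasisRealised_holds) Literature.NumberTheory.Transcendental.arapura2012_cor_15_4_6_holds V →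
      TowerConj.conjT exists_isReal_hodgeModel_holds hodgePQ_independent_of_hodgeModel_holds (ballQuotientUniformisedDatum_of Summit.HodgeConjecture.CorCM.BallQuotient.ballQuotientUniformised_holds) (cmAbelianVarietyRealised_of_eigenbasis exists_isReal_hodgeModel_holds hodgePQ_independent_of_hodgeModel_holds Summit.HodgeConjecture.CorCM.cmAbelianVarietyEigenbasisRealised_holds) Literature.NumberTheory.Transcendental.arapura2012_cor_15_4_6_holds V y = x → x = 0 :=
    fun x y hx hy hyx => TowerConj.eq_zero_of_mem_H10T_of_conjT_eq exists_isReal_hodgeModel_holds hodgePQ_independent_of_hodgeModel_holds (ballQuotientUniformisedDatum_of Summit.HodgeConjecture.CorCM.BallQuotient.ballQuotientUniformised_holds) (cmAbelianVarietyRealised_of_eigenbasis exists_isReal_hodgeModel_holds hodgePQ_independent_of_hodgeModel_holds Summit.HodgeConjecture.CorCM.cmAbelianVarietyEigenbasisRealised_holds) Literature.NumberTheory.Transcendental.arapura2012_cor_15_4_6_holds hx hy hyx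
  obtain ⟨cls, hinj, hhol, hanti, hcls⟩ :=
    h3 F V ((datum413 hDel F V a₀ Φ i).HB τ') ((datum413 hDel F V a₀ Φ i).rhoB τ') (TowerConj.H10T exists_isReal_hodgeModel_holds hodgePQ_independent_of_hodgeModel_holds (ballQuotientUniformisedDatum_of Summit.HodgeConjecture.CorCM.BallQuotient.ballQuotientUniformised_holds) (cmAbelianVarietyRealised_of_eigenbasis exists_isReal_hodgeModel_holds hodgePQ_independent_of_hodgeModel_holds Summit.HodgeConjecture.CorCM.cmAbelianVarietyEigenbasisRealised_holds) Literature.NumberTheory.Transcendental.arapura2012_cor_15_4_6_holds V) (CuspCot.clsHol exists_isReal_hodgeModel_holds hodgePQ_independent_of_hodgeModel_holds Summit.HodgeConjecture.CorCM.BallQuotient.ballQuotientUniformised_holds (cmAbelianVarietyRealised_of_eigenbasis exists_isReal_hodgeModel_holds hodgePQ_independent_of_hodgeModel_holds Summit.HodgeConjecture.CorCM.cmAbelianVarietyEigenbasisRealised_holds) Literature.NumberTheory.Transcendental.arapura2012_cor_15_4_6_holds hV) (CuspCot.clsHol_injective exists_isReal_hodgeModel_holds hodgePQ_independent_of_hodgeModel_holds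 Summit.HodgeConjecture.CorCM.BallQuotient.ballQuotientUniformised_holds (cmAbelianVarietyRealised_of_eigenbasis exists_isReal_hodgeModel_holds hodgePQ_independent_of_hodgeModel_holds Summit.HodgeConjecture.CorCM.cmAbelianVarietyEigenbasisRealised_holds) Literature.NumberTheory.Transcendental.arapura2012_cor_15_4_6_holds hV) heqv hP
      (TowerConj.conjT exists_isReal_hodgeModel_holds hodgePQ_independent_of_hodgeModel_holds (ballQuotientUniformisedDatum_of Summit.HodgeConjecture.CorCM.BallQuotient.ballQuotientUniformised_holds) (cmAbelianVarietyRealised_of_eigenbasis exists_isReal_hodgeModel_holds hodgePQ_independent_of_hodgeModel_holds Summit.HodgeConjecture.CorCM.cmAbelianVarietyEigenbasisRealised_holds) Literature.NumberTheory.Transcendental.arapura2012_cor_15_4_6_holds V) (TowerConj.conjT_injective exists_isReal_hodgeModel_holds hodgePQ_independent_of_hodgeModel_holds (ballQuotientUniformisedDatum_of Summit.HodgeConjecture.CorCM.BallQuotient.ballQuotientUniformised_holds) (cmAbelianVarietyRealised_of_eigenbasis exists_isReal_hodgeModel_holds hodgePQ_independent_of_hodgeModel_holds Summit.HodgeConjecture.CorCM.cmAbelianVarietyEigenbasisRealised_holds)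 Literature.NumberTheory.Transcendental.arapura2012_cor_15_4_6_holds) hcBρ hdisj
  -- the glued harmonic form of a `(1,0)`-family and the two halves of the range
  have hglue : ∀ (j : HodgeCM.TLvl V) (c : ↥(HodgeCM.Model.TowerLevel.towerLevel exists_isReal_hodgeModel_holds hodgePQ_independent_of_hodgeModel_holds (ballQuotientUniformisedDatum_of Summit.HodgeConjecture.CorCM.BallQuotient.ballQuotientUniformised_holds) (cmAbelianVarietyRealised_of_eigenbasis exists_isReal_hodgeModel_holds hodgePQ_independent_of_hodgeModel_holds Summit.HodgeConjecture.CorCM.cmAbelianVarietyEigenbasisRealised_holds) Literature.NumberTheory.Transcendental.arapura2012_cor_15_4_6_holds j.1 j.2))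
      (hc : c ∈ TowerConj.H10L exists_isReal_hodgeModel_holds hodgePQ_independent_of_hodgeModel_holds (ballQuotientUniformisedDatum_of Summit.HodgeConjecture.CorCM.BallQuotient.ballQuotientUniformised_holds) (cmAbelianVarietyRealised_of_eigenbasis exists_isReal_hodgeModel_holds hodgePQ_independent_of_hodgeModel_holds Summit.HodgeConjecture.CorCM.cmAbelianVarietyEigenbasisRealised_holds) Literature.NumberTheory.Transcendental.arapura2012_cor_15_4_6_holds j.1 j.2),
      cls ⟨CuspCot.glue exists_isReal_hodgeModel_holds hodgePQ_independent_of_hodgeModel_holds Summit.HodgeConjecture.CorCM.BallQuotient.ballQuotientUniformised_holds (cmAbelianVarietyRealised_of_eigenbasis exists_isReal_hodgeModel_holds hodgePQ_independent_of_hodgeModel_holds Summit.HodgeConjecture.CorCM.cmAbelianVarietyEigenbasisRealised_holds) hV j.2 (c : Π h : ↥(HodgeCM.HermSpace3.adelicFin V), HodgeCM.Model.TowerLevel.W exists_isReal_hodgeModel_holds hodgePQ_independent_of_hodgeModel_holds (ballQuotientUniformisedDatum_of Summit.HodgeConjecture.CorCM.BallQuotient.ballQuotientUniformised_holds) (cmAbelianVarietyRealised_of_eigenbasis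 exists_isReal_hodgeModel_holds hodgePQ_independent_of_hodgeModel_holds Summit.HodgeConjecture.CorCM.cmAbelianVarietyEigenbasisRealised_holds) j.1 j.2 h),
          holCotForms_le_cohForms (archFactorOf F V) (CuspCot.glue_mem_holCotForms exists_isReal_hodgeModel_holds hodgePQ_independent_of_hodgeModel_holds Summit.HodgeConjecture.CorCM.BallQuotient.ballQuotientUniformised_holds (cmAbelianVarietyRealised_of_eigenbasis exists_isReal_hodgeModel_holds hodgePQ_independent_of_hodgeModel_holds Summit.HodgeConjecture.CorCM.cmAbelianVarietyEigenbasisRealised_holds) Literature.NumberTheory.Transcendental.arapura2012_cor_15_4_6_holds hV c hc)⟩ = ofLevel exists_isReal_hodgeModel_holds hodgePQ_independent_of_hodgeModel_holds (ballQuotientUniformisedDatum_of Summit.HodgeConjecture.CorCM.BallQuotient.ballQuotientUniformised_holds) (cmAbelianVarietyRealised_of_eigenbasis exists_isReal_hodgeModel_holds hodgePQ_independent_of_hodgeModel_holds Summit.HodgeConjecture.CorCM.cmAbelianVarietyEigenbasisRealised_holds) Literature.NumberTheory.Transcendental.arapura2012_cor_15_4_6_holds j.1 j.2 c ∧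
      cls ⟨conjFun F V (CuspCot.glue exists_isReal_hodgeModel_holds hodgePQ_independent_of_hodgeModel_holds Summit.HodgeConjecture.CorCM.BallQuotient.ballQuotientUniformised_holds (cmAbelianVarietyRealised_of_eigenbasis exists_isReal_hodgeModel_holds hodgePQ_independent_of_hodgeModel_holds Summit.HodgeConjecture.CorCM.cmAbelianVarietyEigenbasisRealised_holds) hV j.2 (c : Π h : ↥(HodgeCM.HermSpace3.adelicFin V), HodgeCM.Model.TowerLevel.W exists_isReal_hodgeModel_holds hodgePQ_independent_of_hodgeModel_holds (ballQuotientUniformisedDatum_of Summit.HodgeConjecture.CorCM.BallQuotient.ballQuotientUniformised_holds) (cmAbelianVarietyRealised_of_eigenbasis exists_isReal_hodgeModel_holds hodgePQ_independent_of_hodgeModel_holds Summit.HodgeConjecture.CorCM.cmAbelianVarietyEigenbasisRealised_holds) j.1 j.2 h)),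
          conjFun_mem_cohForms_of_mem_holCotForms (CuspCot.glue_mem_holCotForms exists_isReal_hodgeModel_holds hodgePQ_independent_of_hodgeModel_holds Summit.HodgeConjecture.CorCM.BallQuotient.ballQuotientUniformised_holds (cmAbelianVarietyRealised_of_eigenbasis exists_isReal_hodgeModel_holds hodgePQ_independent_of_hodgeModel_holds Summit.HodgeConjecture.CorCM.cmAbelianVarietyEigenbasisRealised_holds) Literature.NumberTheory.Transcendental.arapura2012_cor_15_4_6_holds hV c hc)⟩ =
        TowerConj.conjT exists_isReal_hodgeModel_holds hodgePQ_independent_of_hodgeModel_holds (ballQuotientUniformisedDatum_of Summit.HodgeConjecture.CorCM.BallQuotient.ballQuotientUniformised_holds) (cmAbelianVarietyRealised_of_eigenbasis exists_isReal_hodgeModel_holds hodgePQ_independent_of_hodgeModel_holds Summit.HodgeConjecture.CorCM.cmAbelianVarietyEigenbasisRealised_holds) Literature.NumberTheory.Transcendental.arapura2012_cor_15_4_6_holds V (ofLevel exists_isReal_hodgeModel_holds hodgePQ_independent_of_hodgeModel_holds (ballQuotientUniformisedDatum_of Summit.HodgeConjecture.CorCM.BallQuotient.ballQuotientUniformised_holds)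 (cmAbelianVarietyRealised_of_eigenbasis exists_isReal_hodgeModel_holds hodgePQ_independent_of_hodgeModel_holds Summit.HodgeConjecture.CorCM.cmAbelianVarietyEigenbasisRealised_holds) Literature.NumberTheory.Transcendental.arapura2012_cor_15_4_6_holds j.1 j.2 c) := fun j c hc =>
    ⟨(hhol ⟨_, CuspCot.glue_mem_holCotForms exists_isReal_hodgeModel_holds hodgePQ_independent_of_hodgeModel_holds Summit.HodgeConjecture.CorCM.BallQuotient.ballQuotientUniformised_holds (cmAbelianVarietyRealised_of_eigenbasis exists_isReal_hodgeModel_holds hodgePQ_independent_of_hodgeModel_holds Summit.HodgeConjecture.CorCM.cmAbelianVarietyEigenbasisRealised_holds) Literature.NumberTheory.Transcendental.arapura2012_cor_15_4_6_holds hV c hc⟩).trans (h1 exists_isReal_hodgeModel_holds hodgePQ_independent_of_hodgeModel_holds Summit.HodgeConjecture.CorCM.BallQuotient.ballQuotientUniformised_holds (cmAbelianVarietyRealised_of_eigenbasis exists_isReal_hodgeModel_holds hodgePQ_independent_of_hodgeModel_holds Summit.HodgeConjecture.CorCM.cmAbelianVarietyEigenbasisRealised_holds) Literature.NumberTheory.Transcendental.arapura2012_cor_15_4_6_holds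 F V hV j.1 j.2 c hc),
      (hanti ⟨_, CuspCot.glue_mem_holCotForms exists_isReal_hodgeModel_holds hodgePQ_independent_of_hodgeModel_holds Summit.HodgeConjecture.CorCM.BallQuotient.ballQuotientUniformised_holds (cmAbelianVarietyRealised_of_eigenbasis exists_isReal_hodgeModel_holds hodgePQ_independent_of_hodgeModel_holds Summit.HodgeConjecture.CorCM.cmAbelianVarietyEigenbasisRealised_holds) Literature.NumberTheory.Transcendental.arapura2012_cor_15_4_6_holds hV c hc⟩).trans
        (congrArg (TowerConj.conjT exists_isReal_hodgeModel_holds hodgePQ_independent_of_hodgeModel_holds (ballQuotientUniformisedDatum_of Summit.HodgeConjecture.CorCM.BallQuotient.ballQuotientUniformised_holds) (cmAbelianVarietyRealised_of_eigenbasis exists_isReal_hodgeModel_holds hodgePQ_independent_of_hodgeModel_holds Summit.HodgeConjecture.CorCM.cmAbelianVarietyEigenbasisRealised_holds) Literature.NumberTheory.Transcendental.arapura2012_cor_15_4_6_holds V) (h1 exists_isReal_hodgeModel_holds hodgePQ_independent_of_hodgeModel_holds Summit.HodgeConjecture.CorCM.BallQuotient.ballQuotientUniformised_holds (cmAbelianVarietyRealised_of_eigenbasis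 exists_isReal_hodgeModel_holds hodgePQ_independent_of_hodgeModel_holds Summit.HodgeConjecture.CorCM.cmAbelianVarietyEigenbasisRealised_holds) Literature.NumberTheory.Transcendental.arapura2012_cor_15_4_6_holds F V hV j.1 j.2 c hc))⟩
  have hsurj : Function.Surjective cls := by
    intro x
    obtain ⟨a, ha, b', hb', hab⟩ := Submodule.mem_sup.1 (Submodule.eq_top_iff'.1 hcompl.sup_eq_top x)
    obtain ⟨b, hb, rfl⟩ := Submodule.mem_map.1 hb'
    obtain ⟨j, c, hc, rfl⟩ := (TowerConj.mem_H10T_iff exists_isReal_hodgeModel_holds hodgePQ_independent_of_hodgeModel_holds (ballQuotientUniformisedDatum_of Summit.HodgeConjecture.CorCM.BallQuotient.ballQuotientUniformised_holds) (cmAbelianVarietyRealised_of_eigenbasis exists_isReal_hodgeModel_holds hodgePQ_independent_of_hodgeModel_holds Summit.HodgeConjecture.CorCM.cmAbelianVarietyEigenbasisRealised_holds) Literature.NumberTheory.Transcendental.arapura2012_cor_15_4_6_holds V a).1 ha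
    obtain ⟨j', c', hc', rfl⟩ := (TowerConj.mem_H10T_iff exists_isReal_hodgeModel_holds hodgePQ_independent_of_hodgeModel_holds (ballQuotientUniformisedDatum_of Summit.HodgeConjecture.CorCM.BallQuotient.ballQuotientUniformised_holds) (cmAbelianVarietyRealised_of_eigenbasis exists_isReal_hodgeModel_holds hodgePQ_independent_of_hodgeModel_holds Summit.HodgeConjecture.CorCM.cmAbelianVarietyEigenbasisRealised_holds) Literature.NumberTheory.Transcendental.arapura2012_cor_15_4_6_holds V b).1 hb
    refine ⟨⟨CuspCot.glue exists_isReal_hodgeModel_holds hodgePQ_independent_of_hodgeModel_holds Summit.HodgeConjecture.CorCM.BallQuotient.ballQuotientUniformised_holds (cmAbelianVarietyRealised_of_eigenbasis exists_isReal_hodgeModel_holds hodgePQ_independent_of_hodgeModel_holds Summit.HodgeConjecture.CorCM.cmAbelianVarietyEigenbasisRealised_holds) hV j.2 (c : Π h : ↥(HodgeCM.HermSpace3.adelicFin V), HodgeCM.Model.TowerLevel.W exists_isReal_hodgeModel_holds hodgePQ_independent_of_hodgeModel_holds (ballQuotientUniformisedDatum_of Summit.HodgeConjecture.CorCM.BallQuotient.ballQuotientUniformised_holds)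 (cmAbelianVarietyRealised_of_eigenbasis exists_isReal_hodgeModel_holds hodgePQ_independent_of_hodgeModel_holds Summit.HodgeConjecture.CorCM.cmAbelianVarietyEigenbasisRealised_holds) j.1 j.2 h),
        holCotForms_le_cohForms (archFactorOf F V) (CuspCot.glue_mem_holCotForms exists_isReal_hodgeModel_holds hodgePQ_independent_of_hodgeModel_holds Summit.HodgeConjecture.CorCM.BallQuotient.ballQuotientUniformised_holds (cmAbelianVarietyRealised_of_eigenbasis exists_isReal_hodgeModel_holds hodgePQ_independent_of_hodgeModel_holds Summit.HodgeConjecture.CorCM.cmAbelianVarietyEigenbasisRealised_holds) Literature.NumberTheory.Transcendental.arapura2012_cor_15_4_6_holds hV c hc)⟩ +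
      ⟨conjFun F V (CuspCot.glue exists_isReal_hodgeModel_holds hodgePQ_independent_of_hodgeModel_holds Summit.HodgeConjecture.CorCM.BallQuotient.ballQuotientUniformised_holds (cmAbelianVarietyRealised_of_eigenbasis exists_isReal_hodgeModel_holds hodgePQ_independent_of_hodgeModel_holds Summit.HodgeConjecture.CorCM.cmAbelianVarietyEigenbasisRealised_holds) hV j'.2 (c' : Π h : ↥(HodgeCM.HermSpace3.adelicFin V), HodgeCM.Model.TowerLevel.W exists_isReal_hodgeModel_holds hodgePQ_independent_of_hodgeModel_holds (ballQuotientUniformisedDatum_of Summit.HodgeConjecture.CorCM.BallQuotient.ballQuotientUniformised_holds) (cmAbelianVarietyRealised_of_eigenbasis exists_isReal_hodgeModel_holds hodgePQ_independent_of_hodgeModel_holds Summit.HodgeConjecture.CorCM.cmAbelianVarietyEigenbasisRealised_holds) j'.1 j'.2 h)),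
        conjFun_mem_cohForms_of_mem_holCotForms (CuspCot.glue_mem_holCotForms exists_isReal_hodgeModel_holds hodgePQ_independent_of_hodgeModel_holds Summit.HodgeConjecture.CorCM.BallQuotient.ballQuotientUniformised_holds (cmAbelianVarietyRealised_of_eigenbasis exists_isReal_hodgeModel_holds hodgePQ_independent_of_hodgeModel_holds Summit.HodgeConjecture.CorCM.cmAbelianVarietyEigenbasisRealised_holds) Literature.NumberTheory.Transcendental.arapura2012_cor_15_4_6_holds hV c' hc')⟩, ?_⟩
    rw [map_add, (hglue j c hc).1, (hglue j' c' hc').2]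
    exact hab
  refine ⟨LinearEquiv.ofBijective cls ⟨hinj, hsurj⟩, fun g f hgf => ?_, fun f => ?_⟩
  · simp only [LinearEquiv.ofBijective_apply]
    exact hcls g f hgf
  · simp only [LinearEquiv.ofBijective_apply]
    rw [hhol f]
    exact hP f

/-- **The node from the registered stubs.** -/
theorem matsushimaHodgeIsoAt_holds : MatsushimaHodgeIsoAt :=
  matsushimaHodgeIsoAt_holds_of m1_classOfGlueAt_holds stub_M3_cohClassMapWithFormulas

set_option synthInstance.maxHeartbeats 400000 in
set_option maxHeartbeats 8000000 in
/-- **P4-T2 by name** (`F0P4AdmissibleOccursInH1.StubT2MatsushimaHodgeAt`, by-paste type): the underlying injective equivariant linear map. -/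
theorem stubT2_of (h : MatsushimaHodgeIsoAt) : StubT2MatsushimaHodgeAt := by
  intro hDel F _ h6 ι₁ V a₀ Φ hΦ i hn τ'
  obtain ⟨cls, hcls, -⟩ := h hDel F h6 V a₀ Φ hΦ i hn τ'
  exact ⟨cls.toLinearMap, cls.injective, fun g f hgf => hcls g f hgf⟩

set_option synthInstance.maxHeartbeats 400000 in
set_option maxHeartbeats 8000000 in
/-- **hJ3a-S1 by name** (`F0U3CohMultOne.StubS1HodgeMatsushimaDecAt`, by-paste type): `dec := subtype ∘ cls⁻¹`; its equivariance is the node's read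
backwards (★ `archFactorOf_isHonest` ∕ `IsHonest.rightRep_mem_cohForms` supply the membership of the translate). -/
theorem stubS1_of (h : MatsushimaHodgeIsoAt) : StubS1HodgeMatsushimaDecAt := by
  intro hDel F _ h6 ι₁ V a₀ Φ hΦ i hn τ'
  obtain ⟨cls, hcls, -⟩ := h hDel F h6 V a₀ Φ hΦ i hn τ'
  refine ⟨(cohForms (archFactorOf F V)).subtype ∘ₗ (cls.symm : ((datum413 hDel F V a₀ Φ i).HB τ') →ₗ[ℂ] ↥(cohForms (archFactorOf F V))),
    (Submodule.injective_subtype _).comp cls.symm.injective, fun x => (cls.symm x).2, fun g x => ?_⟩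
  obtain ⟨f, rfl⟩ := cls.surjective x
  have hgf : rightRep F V g (f : _) ∈ cohForms (archFactorOf F V) :=
    (P4StubT1ArchFactor.archFactorOf_isHonest F V).rightRep_mem_cohForms f.2 g
  rw [← hcls g f hgf]
  show ((cls.symm (cls ⟨rightRep F V g (f : _), hgf⟩) : ↥(cohForms (archFactorOf F V))) : (adelicDatum F V).Adelic → (Fin 2 → ℂ)) =
    rightRep F V g ((cls.symm (cls f) : ↥(cohForms (archFactorOf F V))) : (adelicDatum F V).Adelic → (Fin 2 → ℂ))
  rw [LinearEquiv.symm_apply_apply, LinearEquiv.symm_apply_apply]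

set_option synthInstance.maxHeartbeats 400000 in
set_option maxHeartbeats 8000000 in
/-- **P2-U1′ by name** (`P2CohSpectrumL2.StubU1RealisationAt`, by-paste type): `RealisedIn` is S1's triple. -/
theorem stubU1_of (h : MatsushimaHodgeIsoAt) : StubU1RealisationAt := by
  intro hDel F _ h6 ι₁ V a₀ Φ hΦ i hn τ'
  obtain ⟨dec, hinj, hmem, heqv⟩ := stubS1_of h hDel F h6 V a₀ Φ hΦ i hn.ge τ'
  exact ⟨dec, hinj, hmem, heqv⟩

/-! ## §4 The crux `H413` BY NAME from this line + the two sibling heads (stated as function hypotheses: their modules are not built on the farm yet) -/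

set_option synthInstance.maxHeartbeats 400000 in
set_option maxHeartbeats 8000000 in
/-- **`H413` from the node and the siblings' heads.**  `hocc_of_T2` is, by import once `Lines/F0_P4AdmissibleOccursInH1` builds,
`fun hT2 => F0P4AdmissibleOccursInH1.admissible_occursInH1_holds_of hT2 F0P4AdmissibleOccursInH1.stubT3ThetaFormsAt_holds` (parent, P4);
`hJ3a_of_S1` is `fun hS1 => F0U3CohMultOne.multiplicity_le_one_printed_holds_of hS1 stub_S2_… stub_S3_… stub_S4_… stub_S5_…` (F0P3); `hdictE` is
F0P2's target.  Conclusion = the crux BY NAME through ★ `Hyp413Closing.H413_of_three_facts_flat`. [cite: Liu2021, Prop. 4.13 (FJcycle.tex l. 2110–2146)] -/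
theorem H413_of_P4a (h1 : StubM1ClassOfGlueAt) (h3 : StubM3CohClassMapWithFormulas)
    (hocc_of_T2 : StubT2MatsushimaHodgeAt → HoccType) (hJ3a_of_S1 : StubS1HodgeMatsushimaDecAt → HJ3aType) (hdictE : HdictEType) :
    Summit.HodgeConjecture.HodgeConjecture.Theses.HCCMUnconditional.H413 :=
  Summit.HodgeConjecture.CorCM.Hyp413Closing.H413_of_three_facts_flat hdictE
    (hJ3a_of_S1 (stubS1_of (matsushimaHodgeIsoAt_holds_of h1 h3)))
    (hocc_of_T2 (stubT2_of (matsushimaHodgeIsoAt_holds_of h1 h3)))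

set_option synthInstance.maxHeartbeats 400000 in
set_option maxHeartbeats 8000000 in
/-- **`H413` from the registered stubs** (+ the siblings' heads and P2's target, as in `H413_of_P4a`). -/
theorem H413_of_stubs
    (hocc_of_T2 : StubT2MatsushimaHodgeAt → HoccType) (hJ3a_of_S1 : StubS1HodgeMatsushimaDecAt → HJ3aType) (hdictE : HdictEType) :
    Summit.HodgeConjecture.HodgeConjecture.Theses.HCCMUnconditional.H413 :=
  H413_of_P4a m1_classOfGlueAt_holds stub_M3_cohClassMapWithFormulas hocc_of_T2 hJ3a_of_S1 hdictE

/-! ## §5 Audit block: the served targets from the registered stubs -/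

/-- P4-T2 from the registered stubs. -/
theorem stubT2MatsushimaHodgeAt_holds : StubT2MatsushimaHodgeAt := stubT2_of matsushimaHodgeIsoAt_holds

/-- hJ3a-S1 from the registered stubs. -/
theorem stubS1HodgeMatsushimaDecAt_holds : StubS1HodgeMatsushimaDecAt := stubS1_of matsushimaHodgeIsoAt_holds

/-- P2-U1′ from the registered stubs. -/
theorem stubU1RealisationAt_holds : StubU1RealisationAt := stubU1_of matsushimaHodgeIsoAt_holds

end Summit.HodgeConjecture.HodgeConjecture.Cruxes.H413.F0P4aMatsushimaHodge

end
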